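import Summits.Ventures.PercRepro.RankLevelSetBiIndepSum

/-! # RankLevelSetBiIndepLR — THE LIKELIHOOD-RATIO MONOTONICITY (LR) OF THE MARKED PROFILES, A THIRD DOOR ABOVE (★★)
(night-1 g26; dossier §38.9)

For a finite matroid `M` on `E` (`#E = n`) and an element `y ∈ E` put, in the vocabulary of
`RankLevelSetBiIndepPerElem`,
* `a_k = yThroughCount M y k = #{Q ∈ D_{k+1} : y ∈ Q}` (the bi-independent `(k+1)`-sets through `y`),
* `b_k = yAvoidCount M y k = #{Z ∈ D_k : y ∉ Z}` (the bi-independent `k`-sets avoiding `y`),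
so that `b_k = a_{n−1−k}` (complementation, `yThroughCount_eq_avoid_compl`) and (★★) reads `b_j ≤ a_j` for `2j + 1 < n`.

**(LR)** (`BiIndepLR M`, a `Prop`, NOT asserted): for all `p ≤ q`, `a_q · b_p ≤ a_p · b_q` — the ratio `b_p / a_p`
is nondecreasing in `p`, i.e. the size law of a random bi-independent set through `y` (minus `y`) lies below the size
law of one avoiding `y` in the likelihood-ratio order; its consecutive form `BiIndepLRStep M` (`a_{p+1} b_p ≤ a_p b_{p+1}`
for every `p`) is equivalent to it when the avoiding counts have no internal zeros (`biIndepLR_of_step`, with that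
positivity as an explicit hypothesis). CENSUS (night-1 g26, own exact code, dossier §38.9): every matroid on ≤ 9
elements (1,719,270 `(M, y)` instances at `n = 9`), every theta graph with ≤ 13 edges, 11,669 random GF(2/3/5)
instances on 10 … 12 elements and 11,979 series extensions up to 12 elements — 0 failures of (LR).

* **`biIndepPerElem_of_LR`**: (LR) implies (★★): at `q = n − 1 − j` the complementation turns `a_q b_j ≤ a_j b_q`
  into `b_j² ≤ a_j²`.
* `biIndepMono_of_LR`, `levelHallUp_members_of_LR`, `hallUp_members_of_LR`: hence the monotone form and gen 23's
  global level-wise theorems (`𝒜 = 𝒵` at every level and C-044 UP at the tight layer) from (LR).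
* `biIndepLR_of_step`: the telescoping of the consecutive form on an interval of levels where `b` is positive.
Nothing here asserts (LR), (★★) or ULC; every declaration has a docstring; imports: the cell's own modules and
Mathlib only. Axioms: standard. -/

namespace PercRepro

open Set Matroid Finset

variable {α : Type} (M : Matroid α) [M.Finite]

omit [M.Finite] in
/-- `a_k = #{Q ∈ D_{k+1} : y ∈ Q}`: the bi-independent `(k+1)`-sets through `y` (the through-`y` profile of §36.1). -/
noncomputable def yThroughCount (y : α) (k : ℕ) : ℕ := {Q ∈ biIndep M (k + 1) | y ∈ Q}.ncard

omit [M.Finite] in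
/-- `b_k = #{Z ∈ D_k : y ∉ Z}`: the bi-independent `k`-sets avoiding `y` (the avoid-`y` profile of §36.1). -/
noncomputable def yAvoidCount (y : α) (k : ℕ) : ℕ := {Z ∈ biIndep M k | y ∉ Z}.ncard

omit [M.Finite] in
/-- **(LR), all-pairs form** (a `Prop`, NOT asserted): for every `y ∈ E` and all `p ≤ q`, `a_q · b_p ≤ a_p · b_q`
(`b_p / a_p` nondecreasing in `p`: the through-`y` size law is below the avoid-`y` size law in the likelihood-ratio order). -/
def BiIndepLR : Prop :=
  ∀ y ∈ M.E, ∀ p q : ℕ, p ≤ q →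
    yThroughCount M y q * yAvoidCount M y p ≤ yThroughCount M y p * yAvoidCount M y q

omit [M.Finite] in
/-- **(LR), consecutive form** (a `Prop`, NOT asserted): `a_{p+1} · b_p ≤ a_p · b_{p+1}` for every `p` — the TP2
condition on the adjacent columns of the `2 × n` array `[a; b]`, the coefficient array of the `y`-marked
bi-independent polynomial `B(t) + u·A(t)`. -/
def BiIndepLRStep : Prop :=
  ∀ y ∈ M.E, ∀ p : ℕ,
    yThroughCount M y (p + 1) * yAvoidCount M y p ≤ yThroughCount M y p * yAvoidCount M y (p + 1)

/-- **Complementation of the marked profiles**: `a_j = b_{n−1−j}` for `j + 1 ≤ n` (`ncard_mem_biIndep_eq_not_mem_compl`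
in the new names). -/
lemma yThroughCount_eq_avoid_compl {y : α} (hy : y ∈ M.E) {j : ℕ} (hj : j + 1 ≤ M.E.ncard) :
    yThroughCount M y j = yAvoidCount M y (M.E.ncard - 1 - j) :=
  ncard_mem_biIndep_eq_not_mem_compl M hy hj

/-- **(LR) implies (★★)**: for `2j + 1 < n` take `q = n − 1 − j ≥ j`; then `a_q = b_j` and `b_q = a_j`, so the
likelihood-ratio inequality `a_q b_j ≤ a_j b_q` reads `b_j² ≤ a_j²`. -/
theorem biIndepPerElem_of_LR (h : BiIndepLR M) : BiIndepPerElem M := by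
  intro y hy j hj
  have hq : j ≤ M.E.ncard - 1 - j := by omega
  have hLR := h y hy j (M.E.ncard - 1 - j) hq
  have ha : yThroughCount M y (M.E.ncard - 1 - j) = yAvoidCount M y j := by
    rw [yThroughCount_eq_avoid_compl M hy (by omega)]
    congr 1
    omega
  have hb : yAvoidCount M y (M.E.ncard - 1 - j) = yThroughCount M y j :=
    (yThroughCount_eq_avoid_compl M hy (by omega)).symm
  rw [ha, hb] at hLR
  -- `hLR : b_j * b_j ≤ a_j * a_j`
  have : yAvoidCount M y j ≤ yThroughCount M y j := Nat.mul_self_le_mul_self_iff.mp hLR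
  exact this

/-- **(LR) implies the monotone form of the profile** (through (★★)). -/
theorem biIndepMono_of_LR (h : BiIndepLR M) : BiIndepMono M :=
  biIndepMono_of_perElem M (biIndepPerElem_of_LR M h)

/-- **The global level-wise form at every level from (LR)** (tight layer `#E = p + q`, rank `p`, `q < t < p`). -/
theorem levelHallUp_members_of_LR (h : BiIndepLR M) {p q t : ℕ} (hE : M.E.ncard = p + q)
    (hrk : M.eRank = (p : ℕ∞)) (hqt : q < t) (htp : t < p) :
    ((p + q).choose t : ℚ) * ((cellMembers M p q).ncard : ℚ) ≤
      ((p + q).choose q : ℚ) * ((indepLevelNbhd M p q t (cellMembers M p q)).ncard : ℚ) :=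
  levelHallUp_members_of_perElem M (biIndepPerElem_of_LR M h) hE hrk hqt htp

/-- **The `𝒜 = 𝒵` case of C-044 UP at the tight layer from (LR)**. -/
theorem hallUp_members_of_LR (h : BiIndepLR M) {p q : ℕ} (hE : M.E.ncard = p + q)
    (hrk : M.eRank = (p : ℕ∞)) :
    phiK p q * ((cellMembers M p q).ncard : ℚ) ≤ ((upNbhd M p q (cellMembers M p q)).ncard : ℚ) :=
  hallUp_members_of_perElem M (biIndepPerElem_of_LR M h) hE hrk

omit [M.Finite] in
/-- **Telescoping the consecutive form**: if `a_{k+1} b_k ≤ a_k b_{k+1}` for every `k` and `b_k > 0` for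
`p ≤ k ≤ q`, then `a_q b_p ≤ a_p b_q`. -/
lemma biIndepLR_telescope {y : α} (hstep : ∀ k : ℕ,
      yThroughCount M y (k + 1) * yAvoidCount M y k ≤ yThroughCount M y k * yAvoidCount M y (k + 1))
    {p q : ℕ} (hpq : p ≤ q) (hpos : ∀ k, p ≤ k → k ≤ q → 0 < yAvoidCount M y k) :
    yThroughCount M y q * yAvoidCount M y p ≤ yThroughCount M y p * yAvoidCount M y q := by
  induction q, hpq using Nat.le_induction with
  | base => exact le_rfl
  | succ q hpq ih =>
    have ih' := ih (fun k hk hk' => hpos k hk (by omega))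
    have hs := hstep q
    have hbq : 0 < yAvoidCount M y q := hpos q hpq (by omega)
    -- a_{q+1} b_p b_q ≤ a_q b_{q+1} b_p ≤ a_p b_q b_{q+1}
    have h1 : yThroughCount M y (q + 1) * yAvoidCount M y p * yAvoidCount M y q ≤
        yThroughCount M y p * yAvoidCount M y (q + 1) * yAvoidCount M y q := by
      calc yThroughCount M y (q + 1) * yAvoidCount M y p * yAvoidCount M y q
          = (yThroughCount M y (q + 1) * yAvoidCount M y q) * yAvoidCount M y p := by ring
        _ ≤ (yThroughCount M y q * yAvoidCount M y (q + 1)) * yAvoidCount M y p :=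
            Nat.mul_le_mul_right _ hs
        _ = (yThroughCount M y q * yAvoidCount M y p) * yAvoidCount M y (q + 1) := by ring
        _ ≤ (yThroughCount M y p * yAvoidCount M y q) * yAvoidCount M y (q + 1) :=
            Nat.mul_le_mul_right _ ih'
        _ = yThroughCount M y p * yAvoidCount M y (q + 1) * yAvoidCount M y q := by ring
    exact Nat.le_of_mul_le_mul_right h1 hbq

omit [M.Finite] in
/-- **The consecutive form gives the all-pairs form** wherever the avoiding counts are positive on the interval
`[p, q]` (for the matroid profiles the positive levels form an interval, so this is the equivalence of the two forms
of (LR) on the support; the interval property is not proved here). -/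
theorem biIndepLR_of_step (h : BiIndepLRStep M) {y : α} (hy : y ∈ M.E) {p q : ℕ} (hpq : p ≤ q)
    (hpos : ∀ k, p ≤ k → k ≤ q → 0 < yAvoidCount M y k) :
    yThroughCount M y q * yAvoidCount M y p ≤ yThroughCount M y p * yAvoidCount M y q :=
  biIndepLR_telescope M (fun k => h y hy k) hpq hpos

end PercRepro
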